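import Summits.CriticalPhenomena.PercolationContinuityZ3.Theorems.PercNearOneGluingNoHeavyLowerTailAntitheticCycleOplusBoxes
import Summits.CriticalPhenomena.PercolationContinuityZ3.Theorems.PercNearOneGluingNoHeavyLowerTailAntitheticSealing
import HarnessLib

/-!
# `NoHeavyLowerTail` (stmt-CriticalPhenomena-4575) — antithetic cluster pairs: tools for the CYCLE + EAR box scheme
# (THEOREM Θ², HOME/MEMO-gen63.md §3; prim-hp-2 gen 63)

Support file (`--supports stmt-CriticalPhenomena-4575`, hull-port prover `prim-hp-2`, gen 63).  No definitions, no named facts, no sorries;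
standard axioms.  Setting: a cycle `v 0 = s, …, v (n-1), v n = v 0` (`n ≥ 3`, pairs `Cyc.edge v i`, `C = Cyc.edgeSet n v`) and an EAR
`u 0 = v α, u 1, …, u ℓ = v β` (`α < β < n`, `ℓ ≥ 1`, interior vertices fresh, pairs `Cyc.edge u j`, `R = Cyc.edgeSet ℓ u`); the θ-graph
`E = C ∪ R`.  Generic facts used by the box scheme of …AntitheticEarSpanBoxes / …EarSpanDom (HOME/MEMO-gen63.md §3):
* `Antithetic.reach_chain` — consecutive pairs in an edge set give reachability along a sequence;
* `Antithetic.cluster_subset_of_closed` / `not_mem_cluster_of_closed` — a set closed under the pairs of an edge set contains the clusters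
  of its elements (the sealing lemma of …AntitheticSealing, packaged);
* `Antithetic.Cyc.ear_vertex_cases`, `ear_edge_inj`, `ear_edge_ne` — index bookkeeping for the ear;
* `Antithetic.Cyc.ear_closed_of_idx` — a vertex set described by cycle indices `I` and ear indices `J` is closed under the pairs
  of `G ⊆ E` as soon as, for every cycle pair and for the two end pairs of the ear, either both endpoints have the same status or the
  pair is not in `G` (the form in which all "sealed set" arguments of the scheme are discharged by index arithmetic).
[cite: VandenbergHaggstromKahn2005, §1 p. 3 (open cluster `C_s`)]
-/

noncomputable section

namespace Summit.CriticalPhenomena.PercolationContinuityZ3.Theorems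

open Literature.Probability.Percolation
open scoped Classical

namespace Antithetic

section Generic

variable {V : Type*}

/-- Consecutive pairs `f i f (i+1)` (`a ≤ i < b`) of an edge set `G` join `f a` to `f b` in the open graph of `G`. [folklore] -/
theorem reach_chain (G : Set (Sym2 V)) (f : ℕ → V) {a b : ℕ} (hab : a ≤ b)
    (h : ∀ i, a ≤ i → i < b → s(f i, f (i + 1)) ∈ G) : (openGraph G).Reachable (f a) (f b) := by
  induction b, hab using Nat.le_induction with
  | base => exact SimpleGraph.Reachable.refl _
  | succ b hab ih =>
    refine (ih fun i hai hib => h i hai (Nat.lt_succ_of_lt hib)).trans ?_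
    by_cases heq : f b = f (b + 1)
    · rw [← heq]
    · exact ((openGraph_adj G _ _).2 ⟨h b hab (Nat.lt_succ_self b), heq⟩).reachable

/-- A set containing `s` and closed under the pairs of `G` contains the open cluster of `s`. [folklore] -/
theorem cluster_subset_of_closed (G : Set (Sym2 V)) (s : V) (S : Set V) (hs : s ∈ S)
    (hcl : ∀ a b, a ∈ S → s(a, b) ∈ G → b ∈ S) : openCluster G s ⊆ S := by
  intro x hx
  have h := reachable_of_sealed G G s Sᶜ (fun h => (Set.mem_compl_iff _ _).1 h hs) (fun _ _ _ _ => Iff.rfl)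
    (fun a b ha hb hab => (Set.mem_compl_iff _ _).1 hb (hcl a b (not_not.1 fun h => ha ((Set.mem_compl_iff _ _).2 h)) hab)) hx
  by_contra hxS
  exact h.2 ((Set.mem_compl_iff _ _).2 hxS)

/-- A set closed under the pairs of `G`, containing `y` but not `s`, shows `y ∉ openCluster G s`. [folklore] -/
theorem not_mem_cluster_of_closed (G : Set (Sym2 V)) (s y : V) (S : Set V) (hy : y ∈ S) (hs : s ∉ S)
    (hcl : ∀ a b, a ∈ S → s(a, b) ∈ G → b ∈ S) : y ∉ openCluster G s := by
  intro h
  exact hs (cluster_subset_of_closed G y S hy hcl (SimpleGraph.Reachable.symm h))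

end Generic

namespace Cyc

variable {V : Type*} {n : ℕ} {v : ℕ → V} (hn : 3 ≤ n) (hinj : ∀ i j, i < n → j < n → v i = v j → i = j) (hper : v n = v 0)
  {ℓ : ℕ} {u : ℕ → V} (hℓ : 1 ≤ ℓ) {α β : ℕ} (hαβ : α < β) (hβn : β < n) (hu0 : u 0 = v α) (huℓ : u ℓ = v β)
  (hfresh : ∀ j, 0 < j → j < ℓ → ∀ i, i ≤ n → u j ≠ v i)
  (huinj : ∀ i j, i ≤ ℓ → j ≤ ℓ → u i = u j → i = j)

/-- **Where an ear vertex can sit on the cycle.**  If `u j = v i` (`j ≤ ℓ`, `i ≤ n`) then `j = 0` and `v i = v α`, or `j = ℓ` and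
`i = β`. [this work] -/
theorem ear_vertex_cases (hn : 3 ≤ n) (hinj : ∀ i j, i < n → j < n → v i = v j → i = j) (hper : v n = v 0)
    (hβ0 : 0 < β) (hβn : β < n)
    (hu0 : u 0 = v α) (huℓ : u ℓ = v β) (hfresh : ∀ j, 0 < j → j < ℓ → ∀ i, i ≤ n → u j ≠ v i)
    {j i : ℕ} (hj : j ≤ ℓ) (hi : i ≤ n) (h : u j = v i) :
    (j = 0 ∧ v i = v α) ∨ (j = ℓ ∧ i = β) := by
  by_cases hj0 : j = 0
  · left; exact ⟨hj0, by rw [← h, hj0, hu0]⟩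
  by_cases hjℓ : j = ℓ
  · right; refine ⟨hjℓ, ?_⟩
    rw [hjℓ, huℓ] at h
    rcases idx_eq hn hinj hper hβn.le hi h with h' | ⟨h1, h2⟩ | ⟨h1, h2⟩ <;> omega
  · exact absurd h (hfresh j (Nat.pos_of_ne_zero hj0) (lt_of_le_of_ne hj hjℓ) i hi)

/-- Distinct ear pairs are distinct. [this work] -/
theorem ear_edge_inj (huinj : ∀ i j, i ≤ ℓ → j ≤ ℓ → u i = u j → i = j) {j j' : ℕ} (hj : j < ℓ) (hj' : j' < ℓ)
    (h : edge u j = edge u j') : j = j' := by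
  unfold edge at h
  rcases Sym2.eq_iff.1 h with ⟨h1, -⟩ | ⟨h1, h2⟩
  · exact huinj j j' hj.le hj'.le h1
  · have := huinj j (j' + 1) hj.le hj' h1
    have := huinj (j + 1) j' hj hj'.le h2
    omega

/-- For an ear with at least two pairs, no ear pair is a cycle pair (the interior vertices are fresh). [this work] -/
theorem ear_edge_ne (hfresh : ∀ j, 0 < j → j < ℓ → ∀ i, i ≤ n → u j ≠ v i) (hℓ2 : 2 ≤ ℓ)
    {j i : ℕ} (hj : j < ℓ) (hi : i < n) : edge u j ≠ edge v i := by
  intro h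
  unfold edge at h
  rcases Sym2.eq_iff.1 h with ⟨h1, h2⟩ | ⟨h1, h2⟩
  · by_cases hj0 : j = 0
    · subst hj0
      exact hfresh 1 Nat.one_pos (by omega) (i + 1) (by omega) h2
    · exact hfresh j (Nat.pos_of_ne_zero hj0) hj i hi.le h1
  · by_cases hj0 : j = 0
    · subst hj0
      exact hfresh 1 Nat.one_pos (by omega) i hi.le h2
    · exact hfresh j (Nat.pos_of_ne_zero hj0) hj (i + 1) (by omega) h1

/-- Membership of a cycle vertex in an index-described set. [this work] -/
theorem mem_idxSet_v (hinj : ∀ i j, i < n → j < n → v i = v j → i = j) (hper : v n = v 0) (hn : 3 ≤ n)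
    (hfresh : ∀ j, 0 < j → j < ℓ → ∀ i, i ≤ n → u j ≠ v i)
    (I : ℕ → Prop) (J : ℕ → Prop) (h0n : I 0 ↔ I n) {i : ℕ} (hi : i ≤ n) :
    v i ∈ ({x | ∃ i, i ≤ n ∧ I i ∧ x = v i} ∪ {x | ∃ j, 0 < j ∧ j < ℓ ∧ J j ∧ x = u j} : Set V) ↔ I i := by
  constructor
  · rintro (⟨i', hi', hI, he⟩ | ⟨j, hj0, hjℓ, -, he⟩)
    · rcases idx_eq hn hinj hper hi hi' he with h' | ⟨h1, h2⟩ | ⟨h1, h2⟩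
      · rwa [h']
      · rw [h1]; rw [h2] at hI; exact h0n.2 hI
      · rw [h1]; rw [h2] at hI; exact h0n.1 hI
    · exact absurd he.symm (hfresh j hj0 hjℓ i hi)
  · exact fun h => Or.inl ⟨i, hi, h, rfl⟩

/-- Membership of an interior ear vertex in an index-described set. [this work] -/
theorem mem_idxSet_u (hfresh : ∀ j, 0 < j → j < ℓ → ∀ i, i ≤ n → u j ≠ v i)
    (huinj : ∀ i j, i ≤ ℓ → j ≤ ℓ → u i = u j → i = j)
    (I : ℕ → Prop) (J : ℕ → Prop) {j : ℕ} (hj0 : 0 < j) (hjℓ : j < ℓ) :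
    u j ∈ ({x | ∃ i, i ≤ n ∧ I i ∧ x = v i} ∪ {x | ∃ j, 0 < j ∧ j < ℓ ∧ J j ∧ x = u j} : Set V) ↔ J j := by
  constructor
  · rintro (⟨i', hi', -, he⟩ | ⟨j', hj0', hjℓ', hJ, he⟩)
    · exact absurd he (hfresh j hj0 hjℓ i' hi')
    · rwa [huinj j j' hjℓ.le hjℓ'.le he]
  · exact fun h => Or.inr ⟨j, hj0, hjℓ, h, rfl⟩

/-- **Closure by index arithmetic.**  Let `G ⊆ C ∪ R` and `S = {v i : i ≤ n, I i} ∪ {u j : 0 < j < ℓ, J j}`.  Suppose: `I 0 ↔ I n`;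
for every cycle pair `i < n`, either `I i ↔ I (i+1)` or `edge v i ∉ G`; for every interior ear pair either `J j ↔ J (j+1)` or it is not
in `G`; for the first ear pair (when `ℓ ≥ 2`) either `I α ↔ J 1` or it is not in `G`; for the last one (when `ℓ ≥ 2`) either
`J (ℓ-1) ↔ I β` or it is not in `G`; for a chord (`ℓ = 1`) either `I α ↔ I β` or it is not in `G`.  Then `S` is closed under the pairs
of `G`. [this work] -/
theorem ear_closed_of_idx (hn : 3 ≤ n) (hinj : ∀ i j, i < n → j < n → v i = v j → i = j) (hper : v n = v 0)
    (hℓ : 1 ≤ ℓ) (hαn : α ≤ n) (hβn : β < n) (hu0 : u 0 = v α) (huℓ : u ℓ = v β)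
    (hfresh : ∀ j, 0 < j → j < ℓ → ∀ i, i ≤ n → u j ≠ v i)
    (huinj : ∀ i j, i ≤ ℓ → j ≤ ℓ → u i = u j → i = j)
    (G : Set (Sym2 V)) (hG : G ⊆ edgeSet n v ∪ edgeSet ℓ u) (I : ℕ → Prop) (J : ℕ → Prop) (h0n : I 0 ↔ I n)
    (hcyc : ∀ i, i < n → (I i ↔ I (i + 1)) ∨ edge v i ∉ G)
    (hearI : ∀ j, 0 < j → j + 1 < ℓ → (J j ↔ J (j + 1)) ∨ edge u j ∉ G)
    (hearA : 2 ≤ ℓ → (I α ↔ J 1) ∨ edge u 0 ∉ G)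
    (hearB : 2 ≤ ℓ → (J (ℓ - 1) ↔ I β) ∨ edge u (ℓ - 1) ∉ G)
    (hearC : ℓ = 1 → (I α ↔ I β) ∨ edge u 0 ∉ G) :
    ∀ a b, a ∈ ({x | ∃ i, i ≤ n ∧ I i ∧ x = v i} ∪ {x | ∃ j, 0 < j ∧ j < ℓ ∧ J j ∧ x = u j} : Set V) →
      s(a, b) ∈ G → b ∈ ({x | ∃ i, i ≤ n ∧ I i ∧ x = v i} ∪ {x | ∃ j, 0 < j ∧ j < ℓ ∧ J j ∧ x = u j} : Set V) := by
  intro a b ha hab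
  have hmv := fun {i : ℕ} (hi : i ≤ n) => mem_idxSet_v (ℓ := ℓ) (u := u) hinj hper hn hfresh I J h0n hi
  have hmu := fun {j : ℕ} (hj0 : 0 < j) (hjℓ : j < ℓ) => mem_idxSet_u (n := n) (v := v) hfresh huinj I J hj0 hjℓ
  -- status of an ear vertex `u j` (`j ≤ ℓ`): that of `v α`, `J`, or that of `v β`
  have hstat : ∀ j, j ≤ ℓ → (u j ∈ ({x | ∃ i, i ≤ n ∧ I i ∧ x = v i} ∪ {x | ∃ j, 0 < j ∧ j < ℓ ∧ J j ∧ x = u j} : Set V) ↔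
      ((j = 0 → I α) ∧ (0 < j → j < ℓ → J j) ∧ (j = ℓ → I β))) := by
    intro j hj
    by_cases hj0 : j = 0
    · subst hj0
      rw [hu0, hmv hαn]
      exact ⟨fun h => ⟨fun _ => h, fun h0 => absurd h0 (lt_irrefl 0), fun h0 => by omega⟩, fun h => h.1 rfl⟩
    by_cases hjℓ : j = ℓ
    · subst hjℓ
      rw [huℓ, hmv hβn.le]
      exact ⟨fun h => ⟨fun h0 => absurd h0 hj0, fun _ h1 => absurd h1 (lt_irrefl _), fun _ => h⟩, fun h => h.2.2 rfl⟩
    · have hj0' : 0 < j := Nat.pos_of_ne_zero hj0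
      have hjℓ' : j < ℓ := lt_of_le_of_ne hj hjℓ
      rw [hmu hj0' hjℓ']
      exact ⟨fun h => ⟨fun h0 => absurd h0 hj0, fun _ _ => h, fun h1 => absurd h1 hjℓ⟩, fun h => h.2.1 hj0' hjℓ'⟩
  rcases hG hab with ⟨i, hi, he⟩ | ⟨j, hj, he⟩
  · -- a cycle pair `edge v i`
    have hI : I i ↔ I (i + 1) := by
      rcases hcyc i hi with h | h
      · exact h
      · exact absurd (he ▸ hab) h
    unfold edge at he
    rcases Sym2.eq_iff.1 he with ⟨rfl, rfl⟩ | ⟨rfl, rfl⟩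
    · rw [hmv hi.le] at ha
      exact (hmv (by omega : i + 1 ≤ n)).2 (hI.1 ha)
    · rw [hmv (by omega : i + 1 ≤ n)] at ha
      exact (hmv hi.le).2 (hI.2 ha)
  · -- an ear pair `edge u j`
    have hG' : edge u j ∈ G := he ▸ hab
    unfold edge at he
    -- transfer of status across the pair `u j u (j+1)`
    have htrans : (u j ∈ ({x | ∃ i, i ≤ n ∧ I i ∧ x = v i} ∪ {x | ∃ j, 0 < j ∧ j < ℓ ∧ J j ∧ x = u j} : Set V)) ↔
        (u (j + 1) ∈ ({x | ∃ i, i ≤ n ∧ I i ∧ x = v i} ∪ {x | ∃ j, 0 < j ∧ j < ℓ ∧ J j ∧ x = u j} : Set V)) := by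
      rw [hstat j hj.le, hstat (j + 1) hj]
      by_cases hℓ1 : ℓ = 1
      · -- chord
        have hj0 : j = 0 := by omega
        subst hj0
        have hab' : I α ↔ I β := by
          rcases hearC hℓ1 with h | h
          · exact h
          · exact absurd hG' h
        constructor
        · intro h; exact ⟨fun h0 => by omega, fun _ h1 => by omega, fun _ => hab'.1 (h.1 rfl)⟩
        · intro h; exact ⟨fun _ => hab'.2 (h.2.2 (by omega)), fun h0 => by omega, fun h1 => by omega⟩
      · have hℓ2 : 2 ≤ ℓ := by omega
        by_cases hj0 : j = 0
        · subst hj0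
          have hAJ : I α ↔ J 1 := by
            rcases hearA hℓ2 with h | h
            · exact h
            · exact absurd hG' h
          constructor
          · intro h; exact ⟨fun h0 => by omega, fun _ _ => hAJ.1 (h.1 rfl), fun h1 => by omega⟩
          · intro h; exact ⟨fun _ => hAJ.2 (h.2.1 (by omega) (by omega)), fun h0 => by omega, fun h1 => by omega⟩
        by_cases hjl : j + 1 = ℓ
        · have hJB : J j ↔ I β := by
            rcases hearB hℓ2 with h | h
            · rwa [show ℓ - 1 = j by omega] at h
            · rw [show ℓ - 1 = j by omega] at h; exact absurd hG' h
          constructor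
          · intro h; exact ⟨fun h0 => by omega, fun _ h1 => by omega, fun _ => hJB.1 (h.2.1 (by omega) hj)⟩
          · intro h; exact ⟨fun h0 => by omega, fun _ _ => hJB.2 (h.2.2 hjl), fun h1 => by omega⟩
        · -- interior pair: both endpoints interior
          have hJJ : J j ↔ J (j + 1) := by
            rcases hearI j (Nat.pos_of_ne_zero hj0) (by omega) with h | h
            · exact h
            · exact absurd hG' h
          constructor
          · intro h; exact ⟨fun h0 => by omega, fun _ _ => hJJ.1 (h.2.1 (by omega) hj), fun h1 => by omega⟩
          · intro h; exact ⟨fun h0 => by omega, fun _ _ => hJJ.2 (h.2.1 (by omega) (by omega)), fun h1 => by omega⟩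
    rcases Sym2.eq_iff.1 he with ⟨rfl, rfl⟩ | ⟨rfl, rfl⟩
    · exact htrans.1 ha
    · exact htrans.2 ha

end Cyc

end Antithetic

end Summit.CriticalPhenomena.PercolationContinuityZ3.Theorems
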